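import Literature.MathematicalPhysics.QuantumFieldTheory.Balaban1983to89.B9Eq368RLipschitzTowerTwoBackgrounds
import Literature.MathematicalPhysics.QuantumFieldTheory.Balaban1983to89.B9Ineq369CurvatureTwoBackgrounds

/-!
# `Balaban1983to89.B9Eq384LaplaceAkLipschitzTwoBackgrounds` — T. Bałaban, *Propagators for lattice gauge theories in a background field*, Commun.
# Math. Phys. **99** (1985) 389–434 [Balaban1985BackgroundPropagators] (3.82)–(3.84) p. 407 with (3.70)–(3.79) pp. 404–406 and (3.26) p. 395: AT `k`
# LEVELS AND A FIXED LATTICE, PRINT's `k`-TH-STEP PRINCIPAL GAUGE-FIXED OPERATOR `P_k(U) = D*D + DR_k(U)D* + aQ_k(U)*Q_k(U)` AND THE ASSEMBLED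
# `Δ_a(U)` OF (3.26) (`B9Eq326OperatorTower.laplaceAk`) ARE LIPSCHITZ IN THE BACKGROUND BETWEEN TWO SMALL BACKGROUNDS —
# `‖P_k(U)x − P_k(U′)x‖ ≤ K·δ·‖x‖`: the one-step (Q1)₂ `B9Eq384LaplaceALipschitzTwoBackgrounds` (this lineage, gen 73) ONE STOREY UP, on the
# `k`-level letters `δ_{Q,k}(U,U′)` (`B9Eq315QTowerLipschitzTwoBackgrounds`), `R_k` ((Q3a)₂-k `B9Eq368RLipschitzTowerTwoBackgrounds`), the owner's
# `δ_{Q,k}` against the flat tower (`B9Eq315QTowerLipschitz`) and (B)₂ on the finest lattice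

statement-level skeleton of published theorems with citation tags; proofs where landed; nothing here is a claim about the Yang–Mills mass gap

PDF held: `paper:balaban1985-cmp99-background-propagators` (journal page = PDF page + 388); pp. 395, 404–407 through the verbatim quotations of
`B9Eq384LaplaceALipschitz` ∕ `B9Thm311SmallFieldCoercivity(Tower)` (NE9 owner gens 80–83), whose assembly `B9Eq384RemainderLetters.norm_laplaceAK_sub_le`
this file instantiates between two backgrounds at `k` levels.

CITATION HEADER (lean-in-tree rule 2026-08-18).  Audit cell `pub-balaban`, sub-cell `t4`, NE9 crux team (2): LEAF PROVER 04
(`b2b-balaban-t4-ne9-formalise-leaf-04` gen 74) — TOWER-SPECIES-PLAN §2 (e), the second junction above the `k`-level two-background averaging letters.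

THE PRINT (as quoted in `B9Thm311SmallFieldCoercivity`).  p. 407, (3.82): *«Δ_a(U′U) = … = Δ_a(U) − V₃(A) − P₁(A) − P₂(A).»*; (3.84): *«Δ_a(U′U) =
Δ_a(U) − V(A) = (I − V(A)G(U))Δ_a(U)»*; p. 406, (3.79): *«|F₂(B)B′| ≤ O(1) sup|B| sup|B′|»*; (3.26) p. 395: `Δ_a(U) = Δ(U) + DR(U)D* + Q_k*(U)aQ_k(U)` with
the `k`-level composites.  `U` is a GENERAL background of the regularity class, `U′ = e^{iηA}` its perturbation.

WHAT IS PROVED (sorry-free; no `Prop` placeholder; no inequality of the paper asserted).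
* §1 **`exists_principalGFk_sub_principalGFk_linear`** — `∃ K ε₀ > 0` (finite-lattice numbers) such that for every pair `U`, `U′` on `T_{L^{n+1} m}`
  with their TOWER data (`α, hα1, hU1, hreg`, regime `50(d+1)α_j ≤ 1`; the base `U′` moreover `α′_j ≤ 1∕128`), bonds AND level averages
  `U1`-valued, `ε`-small (`ε ≤ ε₀`), `δ`-close, finest transporters mutually adjoint: `‖P_k(U)x − P_k(U′)x‖ ≤ K·δ·‖x‖` for
  `P_k(V) = D*_V D_V + D_V R_k(V) D*_V + aQ_k(V)*Q_k(V)` — `norm_laplaceAK_sub_le` with `δP`, `δD`, `MD` by (B)₂ (finest lattice), `δR = C_R·δ`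
  ((Q3a)₂-k), `δQ = C_Q·δ₀` (`norm_QkW_sub_QkW_le`, `C_Q = M_φ′M_φ√(c₁|𝔅(T_m)|∕c₀)(n+1)2^{n+1}75497472(d+1)N`), `MQ = ‖Q_k(1)‖ + C_Q^♭·ε`
  (`norm_QkW_sub_flat_le`, `C_Q^♭ = M_φ′M_φ√(c₁|𝔅(T_m)|∕c₀)(2^{n+1} − 1)102(d+1)²L`), `δ₀ = δ ∧ 2ε`; the real bookkeeping in the private `assemble_budget`
  ((Q1)₂'s, verbatim).
* §2 **`exists_laplaceAk_sub_laplaceAk_le`** — the same for `B9Eq326OperatorTower.laplaceAk` ((3.26) at `k` levels, `= P_k(U)-assembly + Δ′(U)` by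
  `hessOp_apply`): `∃ C_Δ ε₆ > 0`, `‖Δ_a(U)x − Δ_a(U′)x‖ ≤ C_Δ·δ·‖x‖` — §1 plus the curvature part of the finest lattice
  (`B9Ineq369CurvatureTwoBackgrounds.norm_curvOp_sub_le`).
MODEL / HONEST SCOPE.  [folklore] finite-dimensional perturbation bookkeeping at a FIXED lattice and number of levels (`K, ε₀` depend on `L, m, n, η,
c₀, c₁, a, M_φ, M_φ′`, the tower right inverse `∼ (L^d)^{n+1}√|T_m|`, `‖Q_k(1)‖`, the Cauchy constants, the compactness modulus `μ`); both backgrounds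
AND their level averages in the small ball (DISPLAYED: smallness = owner's `B7Eq43AveragedSmallness`, closeness = this lineage's `B7Eq65AverageLipschitz`,
`U1` = an averaging-closed subgroup); the per-level regularity data of both towers DISPLAYED as in the owner's `k`-level files; NOT print's analytic
`V(A)`, NOT uniformity in the lattice or in `k`; a junction of a two-general-backgrounds `k`-level chart, NOT that chart, NOT [B9] Thm 3.11, NOT NE9; NOT
summit progress (cell pub-balaban: NE9 NOT PRINTED ∕ NOT PROVED; spine PROVED 0∕9; rung (B)+1 finite T⁴ — NOT infinite volume, NOT mass gap, NOT Clay).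
NEW file importing `B9Eq368RLipschitzTowerTwoBackgrounds`, `B9Ineq369CurvatureTwoBackgrounds`; nothing of the NE9-owner ∕ leaf-02 ∕ leaf-03 lineages'
files is modified.  Net new unproved facts: 0.
-/

noncomputable section

open scoped InnerProductSpace ComplexConjugate BigOperators

namespace Literature.MathematicalPhysics.QuantumFieldTheory.Balaban1983to89.B9Eq384LaplaceAkLipschitzTwoBackgrounds

open B4Sect5Torus (TSite)
open B9SectCLatticeCarrier (Bond)
open B7Prop1Explicit (U1 Wcx boxVec)
open B9Eq311L2Pairing (WL2)
open B9Eq319QprimeTorus (fineP)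
open B11Eq103H1Complex (SiteL2K BondL2K covDerivL2K covDivL2K laplaceALatticeK RLatticeK)
open B9Eq310HessianOperator (adTransportW principalOpK hessOp hessOp_apply curvOp)
open B9Eq315QTorus (perCfg cornerSite)
open B9Eq315QTower (towerP UlevOf)
open B9Eq315QTowerFlat (perCfg_UlevOf_one_mem_U1 norm_Wcx_UlevOf_one_sub_one_le)
open B9Eq326OperatorTower (RofUk QkW laplaceAk)
open B9Eq368ProjectionRemainder (norm_projR_le)
open B9Eq373DerivativeRemainderL2 (norm_covDerivL2K_le norm_covDivL2K_le)
open B9Eq373DerivativeRemainderTwoBackgrounds (norm_covDerivL2K_sub_le₂ norm_covDivL2K_sub_le₂ norm_principal_sub_le₂)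
open B9Eq384RemainderLetters (norm_laplaceAK_sub_le norm_adTransportW_sub_le)
open B9Eq368RLipschitzTwoBackgrounds (norm_adTransportW_sub_adTransportW_le)
open B9Eq368RLipschitzTowerTwoBackgrounds (exists_RofUk_sub_RofUk_linear)
open B9Eq315QTowerLipschitz (norm_QkW_sub_flat_le)
open B9Eq315QTowerLipschitzTwoBackgrounds (norm_QkW_sub_QkW_le)
open B9Eq310DeltaPrime (plaqHolU)
open B9Thm311SmallFieldClosed (norm_plaqHolU_sub_one_le)
open B9Ineq369CurvatureTwoBackgrounds (norm_curvOp_sub_le)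

/-- THE ASSEMBLY BUDGET (pure real arithmetic, kept out of the main proof's context): the four pieces of `norm_laplaceAK_sub_le` against `K·δ` under
`K_Rε ≤ 1`, `ε ≤ 1`, `δ₀ ≤ δ`, `δ₀ ≤ 2ε`. [folklore] -/
private theorem assemble_budget {d p sd KR CR CQ CQf MQ a ε δ δ₀ : ℝ} (hd : 0 ≤ d) (hsd : sd * sd = d)
    (hKR : 0 ≤ KR) (hCR : 0 ≤ CR) (hCQ : 0 ≤ CQ) (hCQf : 0 ≤ CQf) (hMQ : 0 ≤ MQ) (hε : 0 ≤ ε) (hε1 : ε ≤ 1) (hKε : KR * ε ≤ 1)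
    (hδ : 0 ≤ δ) (hδ₀ : 0 ≤ δ₀) (hδ₀δ : δ₀ ≤ δ) (hδ₀ε : δ₀ ≤ 2 * ε) :
    32 * d * (1 + KR * ε) * p ^ 2 * (KR * δ₀) + 2 * (2 * (1 + KR * ε) * p * sd) * (p * (KR * δ₀) * sd)
        + (2 * (1 + KR * ε) * p * sd) ^ 2 * (CR * δ) + |a| * (CQ * δ₀) * (2 * (MQ + CQf * ε) + CQ * δ₀) ≤
      (64 * d * p ^ 2 * KR + 8 * p ^ 2 * d * KR + 16 * p ^ 2 * d * CR + |a| * CQ * (2 * (MQ + CQf) + 2 * CQ) + 1) * δ := by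
  have h1e : 1 + KR * ε ≤ 2 := by linarith
  have h1e0 : 0 ≤ 1 + KR * ε := by positivity
  have hKδ : KR * δ₀ ≤ KR * δ := mul_le_mul_of_nonneg_left hδ₀δ hKR
  have hA : 32 * d * (1 + KR * ε) * p ^ 2 * (KR * δ₀) ≤ 64 * d * p ^ 2 * KR * δ := by
    calc 32 * d * (1 + KR * ε) * p ^ 2 * (KR * δ₀) = (32 * d * p ^ 2) * ((1 + KR * ε) * (KR * δ₀)) := by ring
      _ ≤ (32 * d * p ^ 2) * (2 * (KR * δ)) :=
          mul_le_mul_of_nonneg_left (mul_le_mul h1e hKδ (by positivity) (by norm_num)) (by positivity)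
      _ = 64 * d * p ^ 2 * KR * δ := by ring
  have hB : 2 * (2 * (1 + KR * ε) * p * sd) * (p * (KR * δ₀) * sd) ≤ 8 * p ^ 2 * d * KR * δ := by
    calc 2 * (2 * (1 + KR * ε) * p * sd) * (p * (KR * δ₀) * sd) = (4 * p ^ 2 * (sd * sd)) * ((1 + KR * ε) * (KR * δ₀)) := by ring
      _ ≤ (4 * p ^ 2 * (sd * sd)) * (2 * (KR * δ)) :=
          mul_le_mul_of_nonneg_left (mul_le_mul h1e hKδ (by positivity) (by norm_num)) (by rw [hsd]; positivity)
      _ = 8 * p ^ 2 * d * KR * δ := by rw [hsd]; ring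
  have hC : (2 * (1 + KR * ε) * p * sd) ^ 2 * (CR * δ) ≤ 16 * p ^ 2 * d * CR * δ := by
    have hsq : (1 + KR * ε) ^ 2 ≤ 4 := by
      calc (1 + KR * ε) ^ 2 ≤ 2 ^ 2 := pow_le_pow_left₀ h1e0 h1e 2
        _ = 4 := by norm_num
    calc (2 * (1 + KR * ε) * p * sd) ^ 2 * (CR * δ) = (1 + KR * ε) ^ 2 * (4 * p ^ 2 * (sd * sd) * (CR * δ)) := by ring
      _ ≤ 4 * (4 * p ^ 2 * (sd * sd) * (CR * δ)) := mul_le_mul_of_nonneg_right hsq (by rw [hsd]; positivity)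
      _ = 16 * p ^ 2 * d * CR * δ := by rw [hsd]; ring
  have hD : |a| * (CQ * δ₀) * (2 * (MQ + CQf * ε) + CQ * δ₀) ≤ |a| * CQ * (2 * (MQ + CQf) + 2 * CQ) * δ := by
    have h2 : 2 * (MQ + CQf * ε) + CQ * δ₀ ≤ 2 * (MQ + CQf) + 2 * CQ := by nlinarith
    have h20 : 0 ≤ 2 * (MQ + CQf * ε) + CQ * δ₀ := by positivity
    calc |a| * (CQ * δ₀) * (2 * (MQ + CQf * ε) + CQ * δ₀) = (|a| * CQ) * (δ₀ * (2 * (MQ + CQf * ε) + CQ * δ₀)) := by ring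
      _ ≤ (|a| * CQ) * (δ * (2 * (MQ + CQf) + 2 * CQ)) :=
          mul_le_mul_of_nonneg_left (mul_le_mul hδ₀δ h2 h20 hδ) (by positivity)
      _ = |a| * CQ * (2 * (MQ + CQf) + 2 * CQ) * δ := by ring
  have h1δ : 0 ≤ 1 * δ := by positivity
  nlinarith [hA, hB, hC, hD, h1δ]

variable {d : ℕ} (L : ℕ) [NeZero L] (m : Fin d → ℕ) [∀ i, NeZero (m i)] (n : ℕ) (hL : 1 ≤ L)
  {𝔸 : Type*} [NormedRing 𝔸] [NormedAlgebra ℂ 𝔸] [CompleteSpace 𝔸] [NormOneClass 𝔸]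
  {W : Type*} [NormedAddCommGroup W] [InnerProductSpace ℂ W] [FiniteDimensional ℂ W] (φ : W ≃ₗ[ℂ] 𝔸) {c₀ c₁ : ℝ} [Fact (0 < c₀)] [Fact (0 < c₁)]

/-! ## §1 The `k`-level principal gauge-fixed operator between two small backgrounds -/

/-- **THE `k`-LEVEL PRINCIPAL GAUGE-FIXED OPERATOR IS LIPSCHITZ IN THE BACKGROUND ON THE SMALL BALL** — (3.82)∕(3.84) «Δ_a(U′U) = Δ_a(U) − V(A)» with
`‖V‖ = O(‖U′U − U‖)` AT A GENERAL `U` and print's `k`-level composites, for the chain's `P_k(V) = D*D + DR_k(V)D* + aQ_k(V)*Q_k(V)`: `∃ K ε₀ > 0`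
(finite-lattice numbers) such that for every pair `U`, `U′` on `T_{L^{n+1} m}` with their tower data (regimes `50(d+1)α_j ≤ 1`, `α′_j ≤ 1∕128`), bonds
and level averages `U1`-valued, `ε`-small (`ε ≤ ε₀`) and `δ`-close, `hRS`, `hRS′`: `‖P_k(U)x − P_k(U′)x‖ ≤ K·δ·‖x‖` — the assembly `norm_laplaceAK_sub_le`
on the two-background letters of (B)₂ (`D`, `D*`, `D*D`, finest lattice), (Q3a)₂-k (`R_k`), `norm_QkW_sub_QkW_le` (`Q_k`) and the owner's
`norm_QkW_sub_flat_le` (bound of `Q_k(U′)`). [cite: Balaban1985BackgroundPropagators, (3.82)–(3.84) p.407, (3.70)–(3.79) pp.404–406, (3.26) p.395] -/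
theorem exists_principalGFk_sub_principalGFk_linear {η : ℝ} (hη : η ≠ 0) (a : ℝ) {Mφ Mφ' : ℝ} (hMφ : 0 ≤ Mφ) (hMφ' : 0 ≤ Mφ')
    (hφ : ∀ w, ‖φ w‖ ≤ Mφ * ‖w‖) (hφ' : ∀ X, ‖φ.symm X‖ ≤ Mφ' * ‖X‖) :
    ∃ K ε₀ : ℝ, 0 < K ∧ 0 < ε₀ ∧ ∀ (U U' : Bond d (towerP L m (n + 1)) → 𝔸ˣ) (α α' : ℕ → ℝ) (hα1 : ∀ j, α j ≤ 1 / 64)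
      (hU1 : ∀ (j : ℕ) (x : B7Prop1Explicit.Site d) (κ : Fin d), perCfg (towerP L m (j + 1)) (UlevOf L m (n + 1) U j) x κ ∈ U1 𝔸)
      (hreg : ∀ (j : ℕ) (y : TSite d (towerP L m j)) (κ : Fin d) (r : Fin d → Fin L),
        ‖((Wcx L (perCfg (towerP L m (j + 1)) (UlevOf L m (n + 1) U j)) (cornerSite L y) κ (boxVec L r) : 𝔸ˣ) : 𝔸) - 1‖ ≤ α j)
      (hα2 : ∀ j, 50 * (d + 1) * α j ≤ 1)
      (hα1' : ∀ j, α' j ≤ 1 / 64)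
      (hU1' : ∀ (j : ℕ) (x : B7Prop1Explicit.Site d) (κ : Fin d), perCfg (towerP L m (j + 1)) (UlevOf L m (n + 1) U' j) x κ ∈ U1 𝔸)
      (hreg' : ∀ (j : ℕ) (y : TSite d (towerP L m j)) (κ : Fin d) (r : Fin d → Fin L),
        ‖((Wcx L (perCfg (towerP L m (j + 1)) (UlevOf L m (n + 1) U' j)) (cornerSite L y) κ (boxVec L r) : 𝔸ˣ) : 𝔸) - 1‖ ≤ α' j)
      (hα2' : ∀ j, 50 * (d + 1) * α' j ≤ 1) (hα128' : ∀ j, α' j ≤ 1 / 128)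
      {ε δ : ℝ}, 0 ≤ ε → ε ≤ ε₀ → 0 ≤ δ →
      (∀ b, U b ∈ U1 𝔸) → (∀ b, U' b ∈ U1 𝔸) → (∀ b, ‖(U b : 𝔸) - 1‖ ≤ ε) → (∀ b, ‖(U' b : 𝔸) - 1‖ ≤ ε) →
      (∀ b, ‖(U b : 𝔸) - (U' b : 𝔸)‖ ≤ δ) →
      (∀ (b : Bond d (towerP L m (n + 1))) (v u : W), ⟪adTransportW φ U b v, u⟫_ℂ = ⟪v, adTransportW φ (fun b => (U b)⁻¹) b u⟫_ℂ) →
      (∀ (b : Bond d (towerP L m (n + 1))) (v u : W), ⟪adTransportW φ U' b v, u⟫_ℂ = ⟪v, adTransportW φ (fun b => (U' b)⁻¹) b u⟫_ℂ) →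
      (∀ (j : ℕ) (b : Bond d (towerP L m (j + 1))), UlevOf L m (n + 1) U j b ∈ U1 𝔸) →
      (∀ (j : ℕ) (b : Bond d (towerP L m (j + 1))), UlevOf L m (n + 1) U' j b ∈ U1 𝔸) →
      (∀ (j : ℕ) (b : Bond d (towerP L m (j + 1))), ‖((UlevOf L m (n + 1) U j b : 𝔸ˣ) : 𝔸) - 1‖ ≤ ε) →
      (∀ (j : ℕ) (b : Bond d (towerP L m (j + 1))), ‖((UlevOf L m (n + 1) U' j b : 𝔸ˣ) : 𝔸) - 1‖ ≤ ε) →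
      (∀ (j : ℕ) (b : Bond d (towerP L m (j + 1))),
        ‖((UlevOf L m (n + 1) U j b : 𝔸ˣ) : 𝔸) - ((UlevOf L m (n + 1) U' j b : 𝔸ˣ) : 𝔸)‖ ≤ δ) →
      ∀ x : BondL2K ℂ d (towerP L m (n + 1)) c₀ W,
        ‖laplaceALatticeK ((η : ℂ))⁻¹ (adTransportW φ U) (adTransportW φ fun b => (U b)⁻¹) (principalOpK φ η U) (RofUk L m n φ η U)
            (QkW L m n φ U hL α hα1 hU1 hreg (c₁ := c₁)) a x -
          laplaceALatticeK ((η : ℂ))⁻¹ (adTransportW φ U') (adTransportW φ fun b => (U' b)⁻¹) (principalOpK φ η U') (RofUk L m n φ η U')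
            (QkW L m n φ U' hL α' hα1' hU1' hreg' (c₁ := c₁)) a x‖ ≤
        K * δ * ‖x‖ := by
  have hc₀ : 0 < c₀ := Fact.out
  have hc : conj ((η : ℂ))⁻¹ = ((η : ℂ))⁻¹ := by rw [map_inv₀, Complex.conj_ofReal]
  have hL0 : (0 : ℝ) < L := by exact_mod_cast hL
  -- the `R_k`-letter between two backgrounds ((Q3a)₂ one storey up)
  obtain ⟨CR, εR₀, hCR, hεR₀, hRlip⟩ := exists_RofUk_sub_RofUk_linear L m n φ (c₀ := c₀) hη hMφ hMφ' hφ hφ'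
  -- constants
  have hp : (0 : ℝ) ≤ ‖((η : ℂ))⁻¹‖ := norm_nonneg _
  have hdn : (0 : ℝ) ≤ (d : ℝ) := Nat.cast_nonneg d
  have hsd : Real.sqrt d * Real.sqrt d = d := Real.mul_self_sqrt hdn
  obtain ⟨KR, hKRdef⟩ : ∃ KR : ℝ, KR = 2 * Mφ * Mφ' := ⟨_, rfl⟩
  have hKR : 0 ≤ KR := by rw [hKRdef]; positivity
  obtain ⟨N, hNdef⟩ : ∃ N : ℝ, N = ((2 * (d * L) + L + L : ℕ) : ℝ) := ⟨_, rfl⟩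
  have hN1 : (1 : ℝ) ≤ N := by
    have : 1 ≤ 2 * (d * L) + L + L := by omega
    rw [hNdef]; exact_mod_cast this
  have hN : 0 < N := by linarith
  obtain ⟨MQ, hMQdef⟩ : ∃ MQ : ℝ, MQ = ‖LinearMap.toContinuousLinearMap
    (QkW L m n φ (fun _ : Bond d (towerP L m (n + 1)) => (1 : 𝔸ˣ)) hL (fun _ => 0) (fun _ => by norm_num)
      (perCfg_UlevOf_one_mem_U1 L m (n + 1)) (norm_Wcx_UlevOf_one_sub_one_le L m (n + 1) (fun _ => 0) (fun _ => le_rfl))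
      (c₀ := c₀) (c₁ := c₁))‖ := ⟨_, rfl⟩
  have hMQ : 0 ≤ MQ := by rw [hMQdef]; positivity
  have hQflat : ∀ y : BondL2K ℂ d (towerP L m (n + 1)) c₀ W,
      ‖QkW L m n φ (fun _ : Bond d (towerP L m (n + 1)) => (1 : 𝔸ˣ)) hL (fun _ => 0) (fun _ => by norm_num)
        (perCfg_UlevOf_one_mem_U1 L m (n + 1)) (norm_Wcx_UlevOf_one_sub_one_le L m (n + 1) (fun _ => 0) (fun _ => le_rfl))
        (c₀ := c₀) (c₁ := c₁) y‖ ≤ MQ * ‖y‖ := fun y => by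
    rw [hMQdef]
    exact (LinearMap.toContinuousLinearMap
      (QkW L m n φ (fun _ : Bond d (towerP L m (n + 1)) => (1 : 𝔸ˣ)) hL (fun _ => 0) (fun _ => by norm_num)
        (perCfg_UlevOf_one_mem_U1 L m (n + 1)) (norm_Wcx_UlevOf_one_sub_one_le L m (n + 1) (fun _ => 0) (fun _ => le_rfl))
        (c₀ := c₀) (c₁ := c₁))).le_opNorm y
  obtain ⟨CQf, hCQfdef⟩ : ∃ CQf : ℝ, CQf = Mφ' * Mφ * Real.sqrt (c₁ * Fintype.card (Bond d m) / c₀) *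
      ((2 ^ (n + 1) - 1) * (102 * ((d : ℝ) + 1) ^ 2 * L)) := ⟨_, rfl⟩
  have h2n : (0 : ℝ) ≤ 2 ^ (n + 1) - 1 := sub_nonneg.2 (one_le_pow₀ (by norm_num))
  have hCQf : 0 ≤ CQf := by rw [hCQfdef]; positivity
  obtain ⟨CQ, hCQdef⟩ : ∃ CQ : ℝ, CQ = Mφ' * Mφ * Real.sqrt (c₁ * Fintype.card (Bond d m) / c₀) *
      (((n : ℝ) + 1) * 2 ^ (n + 1) * (75497472 * ((d : ℝ) + 1) * N)) := ⟨_, rfl⟩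
  have hCQ : 0 ≤ CQ := by rw [hCQdef]; positivity
  obtain ⟨K, hKdef⟩ : ∃ K : ℝ, K = 64 * d * ‖((η : ℂ))⁻¹‖ ^ 2 * KR + 8 * ‖((η : ℂ))⁻¹‖ ^ 2 * d * KR + 16 * ‖((η : ℂ))⁻¹‖ ^ 2 * d * CR +
    |a| * CQ * (2 * (MQ + CQf) + 2 * CQ) + 1 := ⟨_, rfl⟩
  have hK : 0 < K := by rw [hKdef]; positivity
  refine ⟨K, min εR₀ (min (1 / (KR + 1)) (min 1 (1 / (24576 * N)))), hK, by positivity, ?_⟩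
  intro U U' α α' hα1 hU1 hreg hα2 hα1' hU1' hreg' hα2' hα128' ε δ hε hε₀ hδ hUb hU'b hUε hU'ε hUU' hRS hRS' hLb hL'b hLε hL'ε hLL' x
  -- smallness consequences
  have hεR : ε ≤ εR₀ := hε₀.trans (min_le_left _ _)
  have hεK : ε ≤ 1 / (KR + 1) := hε₀.trans ((min_le_right _ _).trans (min_le_left _ _))
  have hε1 : ε ≤ 1 := hε₀.trans ((min_le_right _ _).trans ((min_le_right _ _).trans (min_le_left _ _)))
  have hεN' : ε ≤ 1 / (24576 * N) := hε₀.trans ((min_le_right _ _).trans ((min_le_right _ _).trans (min_le_right _ _)))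
  have hKε1 : KR * ε ≤ 1 := by
    refine (mul_le_mul_of_nonneg_left hεK hKR).trans ?_
    rw [mul_one_div, div_le_one (by positivity)]; linarith
  -- the effective distance `δ₀ = δ ∧ 2ε`
  obtain ⟨δ₀, hδ₀def⟩ : ∃ δ₀ : ℝ, δ₀ = min δ (2 * ε) := ⟨_, rfl⟩
  have hδ₀ : 0 ≤ δ₀ := by rw [hδ₀def]; exact le_min hδ (by positivity)
  have hδ₀δ : δ₀ ≤ δ := by rw [hδ₀def]; exact min_le_left _ _
  have hδ₀ε : δ₀ ≤ 2 * ε := by rw [hδ₀def]; exact min_le_right _ _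
  have hδ₀N : δ₀ ≤ 1 / (12288 * ((2 * (d * L) + L + L : ℕ) : ℝ)) := by
    rw [← hNdef]
    refine hδ₀ε.trans ?_
    have := mul_le_mul_of_nonneg_left hεN' (by norm_num : (0 : ℝ) ≤ 2)
    refine this.trans (le_of_eq ?_)
    field_simp; norm_num
  have hUU'₀ : ∀ b, ‖(U b : 𝔸) - (U' b : 𝔸)‖ ≤ δ₀ := fun b => by
    rw [hδ₀def]
    refine le_min (hUU' b) ?_
    calc ‖(U b : 𝔸) - (U' b : 𝔸)‖ = ‖((U b : 𝔸) - 1) - ((U' b : 𝔸) - 1)‖ := by rw [sub_sub_sub_cancel_right]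
      _ ≤ ‖(U b : 𝔸) - 1‖ + ‖(U' b : 𝔸) - 1‖ := norm_sub_le _ _
      _ ≤ 2 * ε := by linarith [hUε b, hU'ε b]
  have hLL'₀ : ∀ (j : ℕ) (b : Bond d (towerP L m (j + 1))),
      ‖((UlevOf L m (n + 1) U j b : 𝔸ˣ) : 𝔸) - ((UlevOf L m (n + 1) U' j b : 𝔸ˣ) : 𝔸)‖ ≤ δ₀ := fun j b => by
    rw [hδ₀def]
    refine le_min (hLL' j b) ?_
    calc ‖((UlevOf L m (n + 1) U j b : 𝔸ˣ) : 𝔸) - ((UlevOf L m (n + 1) U' j b : 𝔸ˣ) : 𝔸)‖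
        = ‖(((UlevOf L m (n + 1) U j b : 𝔸ˣ) : 𝔸) - 1) - (((UlevOf L m (n + 1) U' j b : 𝔸ˣ) : 𝔸) - 1)‖ := by rw [sub_sub_sub_cancel_right]
      _ ≤ ‖((UlevOf L m (n + 1) U j b : 𝔸ˣ) : 𝔸) - 1‖ + ‖((UlevOf L m (n + 1) U' j b : 𝔸ˣ) : 𝔸) - 1‖ := norm_sub_le _ _
      _ ≤ 2 * ε := by linarith [hLε j b, hL'ε j b]
  -- the finest fibre transporters: `K_Rε`-close to the identity, `K_Rδ₀`-close to each other
  have hεR0 : 0 ≤ KR * ε := mul_nonneg hKR hε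
  have hδR0 : 0 ≤ KR * δ₀ := mul_nonneg hKR hδ₀
  have hR : ∀ (b : Bond d (towerP L m (n + 1))) (w : W), ‖adTransportW φ U b w - w‖ ≤ KR * ε * ‖w‖ := fun b w => by
    have h := norm_adTransportW_sub_le φ hφ hφ' hMφ' U b (hUb b) (hUε b) w
    rw [hKRdef]; linarith
  have hR' : ∀ (b : Bond d (towerP L m (n + 1))) (w : W), ‖adTransportW φ U' b w - w‖ ≤ KR * ε * ‖w‖ := fun b w => by
    have h := norm_adTransportW_sub_le φ hφ hφ' hMφ' U' b (hU'b b) (hU'ε b) w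
    rw [hKRdef]; linarith
  have hRR' : ∀ (b : Bond d (towerP L m (n + 1))) (w : W), ‖adTransportW φ U b w - adTransportW φ U' b w‖ ≤ KR * δ₀ * ‖w‖ := fun b w => by
    have h := norm_adTransportW_sub_adTransportW_le L (towerP L m n) φ hφ hφ' hMφ' U U' b (hUb b) (hU'b b) (hUU'₀ b) w
    rw [hKRdef]; exact h
  -- the letters of `norm_laplaceAK_sub_le`
  have hP : ∀ y : BondL2K ℂ d (towerP L m (n + 1)) c₀ W, ‖principalOpK φ η U y - principalOpK φ η U' y‖ ≤
      32 * d * (1 + KR * ε) * ‖((η : ℂ))⁻¹‖ ^ 2 * (KR * δ₀) * ‖y‖ := fun y => by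
    rw [B9Eq310HessianOperator.principalOpK_eq_comp, B9Eq310HessianOperator.principalOpK_eq_comp, LinearMap.comp_apply,
      LinearMap.comp_apply]
    exact norm_principal_sub_le₂ _ hc hεR0 hδR0 hR hR' hRR' hRS hRS' y
  have hD : ∀ f : SiteL2K ℂ d (towerP L m (n + 1)) c₀ W,
      ‖covDerivL2K ℂ c₀ ((η : ℂ))⁻¹ (adTransportW φ U) f - covDerivL2K ℂ c₀ ((η : ℂ))⁻¹ (adTransportW φ U') f‖ ≤
        ‖((η : ℂ))⁻¹‖ * (KR * δ₀) * Real.sqrt d * ‖f‖ := norm_covDerivL2K_sub_le₂ _ hδR0 hRR'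
  have hDs : ∀ y : BondL2K ℂ d (towerP L m (n + 1)) c₀ W,
      ‖covDivL2K ℂ c₀ ((η : ℂ))⁻¹ (adTransportW φ fun b => (U b)⁻¹) y - covDivL2K ℂ c₀ ((η : ℂ))⁻¹ (adTransportW φ fun b => (U' b)⁻¹) y‖ ≤
        ‖((η : ℂ))⁻¹‖ * (KR * δ₀) * Real.sqrt d * ‖y‖ := norm_covDivL2K_sub_le₂ _ hc hδR0 hRR' hRS hRS'
  have hD₁ : ∀ f : SiteL2K ℂ d (towerP L m (n + 1)) c₀ W,
      ‖covDerivL2K ℂ c₀ ((η : ℂ))⁻¹ (adTransportW φ U') f‖ ≤ 2 * (1 + KR * ε) * ‖((η : ℂ))⁻¹‖ * Real.sqrt d * ‖f‖ :=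
    norm_covDerivL2K_le _ hεR0 hR'
  have hDs₂ : ∀ y : BondL2K ℂ d (towerP L m (n + 1)) c₀ W,
      ‖covDivL2K ℂ c₀ ((η : ℂ))⁻¹ (adTransportW φ fun b => (U b)⁻¹) y‖ ≤ 2 * (1 + KR * ε) * ‖((η : ℂ))⁻¹‖ * Real.sqrt d * ‖y‖ :=
    norm_covDivL2K_le _ hc hεR0 hR hRS
  have hRn₁ : ∀ z : SiteL2K ℂ d (towerP L m (n + 1)) c₀ W, ‖RofUk L m n φ η U' z‖ ≤ ‖z‖ := fun z => by
    unfold RofUk RLatticeK; exact norm_projR_le _ _ z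
  have hRn₂ : ∀ z : SiteL2K ℂ d (towerP L m (n + 1)) c₀ W, ‖RofUk L m n φ η U z‖ ≤ ‖z‖ := fun z => by
    unfold RofUk RLatticeK; exact norm_projR_le _ _ z
  have hRd : ∀ z : SiteL2K ℂ d (towerP L m (n + 1)) c₀ W, ‖RofUk L m n φ η U z - RofUk L m n φ η U' z‖ ≤ CR * δ * ‖z‖ :=
    hRlip U U' hε hεR hδ hUb hU'b hUε hU'ε hUU' hRS hRS' hLb hL'b hLε hL'ε hLL'
  have hQ : ∀ y : BondL2K ℂ d (towerP L m (n + 1)) c₀ W,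
      ‖QkW L m n φ U hL α hα1 hU1 hreg (c₁ := c₁) y - QkW L m n φ U' hL α' hα1' hU1' hreg' (c₁ := c₁) y‖ ≤ CQ * δ₀ * ‖y‖ := fun y => by
    refine (norm_QkW_sub_QkW_le L m n hL φ hMφ hMφ' hφ hφ' U U' α hα1 hU1 hreg hα2 α' hα1' hU1' hreg' hα2' hα128' hL'b hδ₀ hδ₀N hLL'₀
      (c₁ := c₁) y).trans (le_of_eq ?_)
    rw [hCQdef, hNdef]; ring
  have hQ₁ : ∀ y : BondL2K ℂ d (towerP L m (n + 1)) c₀ W, ‖QkW L m n φ U' hL α' hα1' hU1' hreg' (c₁ := c₁) y‖ ≤ (MQ + CQf * ε) * ‖y‖ := fun y => by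
    have h' : ‖QkW L m n φ U' hL α' hα1' hU1' hreg' (c₁ := c₁) y -
        QkW L m n φ (fun _ : Bond d (towerP L m (n + 1)) => (1 : 𝔸ˣ)) hL (fun _ => 0) (fun _ => by norm_num)
          (perCfg_UlevOf_one_mem_U1 L m (n + 1)) (norm_Wcx_UlevOf_one_sub_one_le L m (n + 1) (fun _ => 0) (fun _ => le_rfl))
          (c₁ := c₁) y‖ ≤ CQf * ε * ‖y‖ := by
      refine (norm_QkW_sub_flat_le L m n hL φ hMφ hMφ' hφ hφ' U' α' hα1' hU1' hreg' hα2' hε hL'ε (c₁ := c₁) y).trans (le_of_eq ?_)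
      rw [hCQfdef]; ring
    calc ‖QkW L m n φ U' hL α' hα1' hU1' hreg' (c₁ := c₁) y‖
        = ‖(QkW L m n φ U' hL α' hα1' hU1' hreg' (c₁ := c₁) y -
            QkW L m n φ (fun _ : Bond d (towerP L m (n + 1)) => (1 : 𝔸ˣ)) hL (fun _ => 0) (fun _ => by norm_num)
              (perCfg_UlevOf_one_mem_U1 L m (n + 1)) (norm_Wcx_UlevOf_one_sub_one_le L m (n + 1) (fun _ => 0) (fun _ => le_rfl))
              (c₁ := c₁) y) +
            QkW L m n φ (fun _ : Bond d (towerP L m (n + 1)) => (1 : 𝔸ˣ)) hL (fun _ => 0) (fun _ => by norm_num)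
              (perCfg_UlevOf_one_mem_U1 L m (n + 1)) (norm_Wcx_UlevOf_one_sub_one_le L m (n + 1) (fun _ => 0) (fun _ => le_rfl))
              (c₁ := c₁) y‖ := by
          rw [sub_add_cancel]
      _ ≤ CQf * ε * ‖y‖ + MQ * ‖y‖ := (norm_add_le _ _).trans (add_le_add h' (hQflat y))
      _ = (MQ + CQf * ε) * ‖y‖ := by ring
  have hMD : (0 : ℝ) ≤ 2 * (1 + KR * ε) * ‖((η : ℂ))⁻¹‖ * Real.sqrt d := by positivity
  have hMQ' : 0 ≤ MQ + CQf * ε := by positivity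
  have hδD : (0 : ℝ) ≤ ‖((η : ℂ))⁻¹‖ * (KR * δ₀) * Real.sqrt d := by positivity
  have hδRR : 0 ≤ CR * δ := by positivity
  have hδQ : 0 ≤ CQ * δ₀ := by positivity
  -- the assembly (the real constant is closed by `assemble_budget`, not by unification)
  have key := @norm_laplaceAK_sub_le ℂ _ (BondL2K ℂ d (towerP L m (n + 1)) c₀ W) (SiteL2K ℂ d (towerP L m (n + 1)) c₀ W) (BondL2K ℂ d m c₁ W)
    _ _ _ _ _ _ _ _ (principalOpK φ η U') (principalOpK φ η U)
    (covDerivL2K ℂ c₀ ((η : ℂ))⁻¹ (adTransportW φ U')) (covDerivL2K ℂ c₀ ((η : ℂ))⁻¹ (adTransportW φ U))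
    (RofUk L m n φ η U') (RofUk L m n φ η U)
    (covDivL2K ℂ c₀ ((η : ℂ))⁻¹ (adTransportW φ fun b => (U' b)⁻¹)) (covDivL2K ℂ c₀ ((η : ℂ))⁻¹ (adTransportW φ fun b => (U b)⁻¹))
    (QkW L m n φ U' hL α' hα1' hU1' hreg' (c₁ := c₁)) (QkW L m n φ U hL α hα1 hU1 hreg (c₁ := c₁))
    a _ _ _ _ _ _ hMD hMQ' hδD hδRR hδQ hP hD hDs hD₁ hDs₂ hRn₁ hRn₂ hRd hQ hQ₁ x
  refine key.trans (mul_le_mul_of_nonneg_right ?_ (norm_nonneg _))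
  have hbud := assemble_budget (p := ‖((η : ℂ))⁻¹‖) (a := a) hdn hsd hKR hCR.le hCQ hCQf hMQ hε hε1 hKε1 hδ hδ₀ hδ₀δ hδ₀ε
  rw [hKdef]
  exact hbud

/-! ## §2 The `k`-level ASSEMBLED `Δ_a(U)` of (3.26) between two small backgrounds -/

section Assembled

variable [StarRing 𝔸] [NormedStarGroup 𝔸] [StarModule ℂ 𝔸]

/-- **(3.84) «Δ_a(U′U) = Δ_a(U) − V(A)» WITH `‖V‖ = O(‖U′U − U‖)` FOR THE `k`-LEVEL ASSEMBLED `Δ_a` (`B9Eq326OperatorTower.laplaceAk`) AT A GENERAL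
SMALL `U`**: there are `C_Δ, ε₆ > 0` (finite-lattice numbers) such that for every pair `U`, `U′` on `T_{L^{n+1} m}` with their tower data, bonds and level
averages `U1`-valued, `ε`-small (`ε ≤ ε₆`) and `δ`-close, `hRS`, `hRS′`: `‖Δ_a(U)x − Δ_a(U′)x‖ ≤ C_Δ·δ·‖x‖` — §1 plus the curvature part of the
finest lattice `‖Δ′(U)x − Δ′(U′)x‖ ≤ 384d·C_τM_φ²(|η|^d∕c₀)|η|⁻²·(δ ∧ 2ε)·‖x‖` (`B9Ineq369CurvatureTwoBackgrounds`; `U`'s plaquette holonomies within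
`4ε ≤ 1` of `1`). [cite: Balaban1985BackgroundPropagators, (3.82)–(3.84) p.407, (3.69) p.404, (3.26) p.395] -/
theorem exists_laplaceAk_sub_laplaceAk_le {η : ℝ} (hη : η ≠ 0) (a : ℝ) {Mφ Mφ' : ℝ} (hMφ : 0 ≤ Mφ) (hMφ' : 0 ≤ Mφ')
    (hφ : ∀ w, ‖φ w‖ ≤ Mφ * ‖w‖) (hφ' : ∀ X, ‖φ.symm X‖ ≤ Mφ' * ‖X‖) (τ : 𝔸 →ₗ[ℂ] ℂ) {Cτ : ℝ} (hτ : ∀ X, ‖τ X‖ ≤ Cτ * ‖X‖) (hCτ : 0 ≤ Cτ) :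
    ∃ CΔ ε₆ : ℝ, 0 < CΔ ∧ 0 < ε₆ ∧ ∀ (U U' : Bond d (towerP L m (n + 1)) → 𝔸ˣ) (α α' : ℕ → ℝ) (hα1 : ∀ j, α j ≤ 1 / 64)
      (hU1 : ∀ (j : ℕ) (x : B7Prop1Explicit.Site d) (κ : Fin d), perCfg (towerP L m (j + 1)) (UlevOf L m (n + 1) U j) x κ ∈ U1 𝔸)
      (hreg : ∀ (j : ℕ) (y : TSite d (towerP L m j)) (κ : Fin d) (r : Fin d → Fin L),
        ‖((Wcx L (perCfg (towerP L m (j + 1)) (UlevOf L m (n + 1) U j)) (cornerSite L y) κ (boxVec L r) : 𝔸ˣ) : 𝔸) - 1‖ ≤ α j)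
      (hα2 : ∀ j, 50 * (d + 1) * α j ≤ 1)
      (hα1' : ∀ j, α' j ≤ 1 / 64)
      (hU1' : ∀ (j : ℕ) (x : B7Prop1Explicit.Site d) (κ : Fin d), perCfg (towerP L m (j + 1)) (UlevOf L m (n + 1) U' j) x κ ∈ U1 𝔸)
      (hreg' : ∀ (j : ℕ) (y : TSite d (towerP L m j)) (κ : Fin d) (r : Fin d → Fin L),
        ‖((Wcx L (perCfg (towerP L m (j + 1)) (UlevOf L m (n + 1) U' j)) (cornerSite L y) κ (boxVec L r) : 𝔸ˣ) : 𝔸) - 1‖ ≤ α' j)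
      (hα2' : ∀ j, 50 * (d + 1) * α' j ≤ 1) (hα128' : ∀ j, α' j ≤ 1 / 128)
      {ε δ : ℝ}, 0 ≤ ε → ε ≤ ε₆ → 0 ≤ δ →
      (∀ b, U b ∈ U1 𝔸) → (∀ b, U' b ∈ U1 𝔸) → (∀ b, ‖(U b : 𝔸) - 1‖ ≤ ε) → (∀ b, ‖(U' b : 𝔸) - 1‖ ≤ ε) →
      (∀ b, ‖(U b : 𝔸) - (U' b : 𝔸)‖ ≤ δ) →
      (∀ (b : Bond d (towerP L m (n + 1))) (v u : W), ⟪adTransportW φ U b v, u⟫_ℂ = ⟪v, adTransportW φ (fun b => (U b)⁻¹) b u⟫_ℂ) →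
      (∀ (b : Bond d (towerP L m (n + 1))) (v u : W), ⟪adTransportW φ U' b v, u⟫_ℂ = ⟪v, adTransportW φ (fun b => (U' b)⁻¹) b u⟫_ℂ) →
      (∀ (j : ℕ) (b : Bond d (towerP L m (j + 1))), UlevOf L m (n + 1) U j b ∈ U1 𝔸) →
      (∀ (j : ℕ) (b : Bond d (towerP L m (j + 1))), UlevOf L m (n + 1) U' j b ∈ U1 𝔸) →
      (∀ (j : ℕ) (b : Bond d (towerP L m (j + 1))), ‖((UlevOf L m (n + 1) U j b : 𝔸ˣ) : 𝔸) - 1‖ ≤ ε) →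
      (∀ (j : ℕ) (b : Bond d (towerP L m (j + 1))), ‖((UlevOf L m (n + 1) U' j b : 𝔸ˣ) : 𝔸) - 1‖ ≤ ε) →
      (∀ (j : ℕ) (b : Bond d (towerP L m (j + 1))),
        ‖((UlevOf L m (n + 1) U j b : 𝔸ˣ) : 𝔸) - ((UlevOf L m (n + 1) U' j b : 𝔸ˣ) : 𝔸)‖ ≤ δ) →
      ∀ x : BondL2K ℂ d (towerP L m (n + 1)) c₀ W,
        ‖laplaceAk L m n φ η U hL α hα1 hU1 hreg τ (c₀ := c₀) (c₁ := c₁) a x -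
          laplaceAk L m n φ η U' hL α' hα1' hU1' hreg' τ (c₀ := c₀) (c₁ := c₁) a x‖ ≤ CΔ * δ * ‖x‖ := by
  have hc₀ : 0 < c₀ := Fact.out
  obtain ⟨K, ε₀, hK, hε₀, HP⟩ := exists_principalGFk_sub_principalGFk_linear L m n hL φ (c₀ := c₀) (c₁ := c₁) hη a hMφ hMφ' hφ hφ'
  obtain ⟨Kc, hKcdef⟩ : ∃ Kc : ℝ, Kc = 384 * d * Cτ * Mφ ^ 2 * (|η| ^ d / c₀) * ‖((η : ℂ))⁻¹‖ ^ 2 := ⟨_, rfl⟩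
  have hKc : 0 ≤ Kc := by rw [hKcdef]; positivity
  refine ⟨K + Kc + 1, min ε₀ (1 / 4), by positivity, by positivity, ?_⟩
  intro U U' α α' hα1 hU1 hreg hα2 hα1' hU1' hreg' hα2' hα128' ε δ hε hε₆ hδ hUb hU'b hUε hU'ε hUU' hRS hRS' hLb hL'b hLε hL'ε hLL' x
  have hεε₀ : ε ≤ ε₀ := hε₆.trans (min_le_left _ _)
  have hε4 : 4 * ε ≤ 1 := by have := hε₆.trans (min_le_right _ _); linarith
  have hUb2 : ∀ b : Bond d (towerP L m (n + 1)), ‖(U b : 𝔸)‖ ≤ 1 ∧ ‖(((U b)⁻¹ : 𝔸ˣ) : 𝔸)‖ ≤ 1 := fun b => B7Prop1Explicit.mem_U1.1 (hUb b)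
  have hU'b2 : ∀ b : Bond d (towerP L m (n + 1)), ‖(U' b : 𝔸)‖ ≤ 1 ∧ ‖(((U' b)⁻¹ : 𝔸ˣ) : 𝔸)‖ ≤ 1 := fun b => B7Prop1Explicit.mem_U1.1 (hU'b b)
  -- the effective distance `δ₀ = δ ∧ 2ε` for the curvature part
  obtain ⟨δ₀, hδ₀def⟩ : ∃ δ₀ : ℝ, δ₀ = min δ (2 * ε) := ⟨_, rfl⟩
  have hδ₀ : 0 ≤ δ₀ := by rw [hδ₀def]; exact le_min hδ (by positivity)
  have hδ₀δ : δ₀ ≤ δ := by rw [hδ₀def]; exact min_le_left _ _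
  have hUU'₀ : ∀ b, ‖(U b : 𝔸) - (U' b : 𝔸)‖ ≤ δ₀ := fun b => by
    rw [hδ₀def]
    refine le_min (hUU' b) ?_
    calc ‖(U b : 𝔸) - (U' b : 𝔸)‖ = ‖((U b : 𝔸) - 1) - ((U' b : 𝔸) - 1)‖ := by rw [sub_sub_sub_cancel_right]
      _ ≤ ‖(U b : 𝔸) - 1‖ + ‖(U' b : 𝔸) - 1‖ := norm_sub_le _ _
      _ ≤ 2 * ε := by linarith [hUε b, hU'ε b]
  -- the principal part
  have hP := HP U U' α α' hα1 hU1 hreg hα2 hα1' hU1' hreg' hα2' hα128' hε hεε₀ hδ hUb hU'b hUε hU'ε hUU' hRS hRS' hLb hL'b hLε hL'ε hLL' x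
  -- the curvature part
  have hpl : ∀ p : B9SectCLatticeCarrier.Plaq d (towerP L m (n + 1)), ‖(plaqHolU U p : 𝔸) - 1‖ ≤ 4 * ε := norm_plaqHolU_sub_one_le hUb hUε
  have hC : ‖curvOp φ τ η U x - curvOp φ τ η U' x‖ ≤ Kc * δ₀ * ‖x‖ := by
    refine (norm_curvOp_sub_le φ hτ hCτ hφ η hUb2 hU'b2 hδ₀ hUU'₀ hε4 hpl hMφ x).trans (le_of_eq ?_)
    rw [hKcdef]; ring
  -- the decomposition `Δ_a(V) = P_k(V)-assembly + Δ′(V)`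
  have hV_eq : ∀ (V : Bond d (towerP L m (n + 1)) → 𝔸ˣ) (β : ℕ → ℝ) (hβ : ∀ j, β j ≤ 1 / 64)
      (hV1 : ∀ (j : ℕ) (x : B7Prop1Explicit.Site d) (κ : Fin d), perCfg (towerP L m (j + 1)) (UlevOf L m (n + 1) V j) x κ ∈ U1 𝔸)
      (hregV : ∀ (j : ℕ) (y : TSite d (towerP L m j)) (κ : Fin d) (r : Fin d → Fin L),
        ‖((Wcx L (perCfg (towerP L m (j + 1)) (UlevOf L m (n + 1) V j)) (cornerSite L y) κ (boxVec L r) : 𝔸ˣ) : 𝔸) - 1‖ ≤ β j),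
      laplaceAk L m n φ η V hL β hβ hV1 hregV τ (c₀ := c₀) (c₁ := c₁) a x =
        laplaceALatticeK ((η : ℂ))⁻¹ (adTransportW φ V) (adTransportW φ fun b => (V b)⁻¹) (principalOpK φ η V) (RofUk L m n φ η V)
          (QkW L m n φ V hL β hβ hV1 hregV (c₁ := c₁)) a x + curvOp φ τ η V x := by
    intro V β hβ hV1 hregV
    show laplaceALatticeK ((η : ℂ))⁻¹ (adTransportW φ V) (adTransportW φ fun b => (V b)⁻¹) (hessOp φ η V τ) (RofUk L m n φ η V)
        (QkW L m n φ V hL β hβ hV1 hregV (c₁ := c₁)) a x = _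
    simp only [laplaceALatticeK, B11Eq103H1Complex.laplaceAK_apply, hessOp_apply]
    abel
  rw [hV_eq U α hα1 hU1 hreg, hV_eq U' α' hα1' hU1' hreg', add_sub_add_comm]
  calc _ ≤ ‖laplaceALatticeK ((η : ℂ))⁻¹ (adTransportW φ U) (adTransportW φ fun b => (U b)⁻¹) (principalOpK φ η U) (RofUk L m n φ η U)
            (QkW L m n φ U hL α hα1 hU1 hreg (c₁ := c₁)) a x -
          laplaceALatticeK ((η : ℂ))⁻¹ (adTransportW φ U') (adTransportW φ fun b => (U' b)⁻¹) (principalOpK φ η U') (RofUk L m n φ η U')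
            (QkW L m n φ U' hL α' hα1' hU1' hreg' (c₁ := c₁)) a x‖ +
        ‖curvOp φ τ η U x - curvOp φ τ η U' x‖ := norm_add_le _ _
    _ ≤ K * δ * ‖x‖ + Kc * δ₀ * ‖x‖ := add_le_add hP hC
    _ ≤ K * δ * ‖x‖ + Kc * δ * ‖x‖ := by
        have := mul_le_mul_of_nonneg_left hδ₀δ hKc
        nlinarith [norm_nonneg x]
    _ ≤ (K + Kc + 1) * δ * ‖x‖ := by nlinarith [norm_nonneg x, mul_nonneg hδ (norm_nonneg x)]

end Assembled

end Literature.MathematicalPhysics.QuantumFieldTheory.Balaban1983to89.B9Eq384LaplaceAkLipschitzTwoBackgrounds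

end
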